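import Summits.BirchSwinnertonDyer.BirchSwinnertonDyer.Theses.EdixhovenFibreFiveSeven
import Summits.BirchSwinnertonDyer.BirchSwinnertonDyer.Theorems.ManinLocalTwoThreeManinPrimeToAdditiveFiveLeKatoReduction
import Summits.BirchSwinnertonDyer.BirchSwinnertonDyer.Theorems.ManinLocalTwoThreeManinPrimeToAdditiveFiveLeUpperAnchorOfFacts
import Summits.BirchSwinnertonDyer.BirchSwinnertonDyer.Theorems.AdditiveKolyvaginRoadManinFrameTransport
import Summits.BirchSwinnertonDyer.Rank1Residual.Additive.GordTorsionFiveSeven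
import Summits.BirchSwinnertonDyer.Rank1Residual.Additive.GordKodairaType
import Literature.NumberTheory.EllipticCurves.ManinConstantConductorLe300000
import Literature.NumberTheory.EllipticCurves.IsogenyIdProofs
import HarnessLib

/-!
# Route `ManinLocalTwoThree`, residual crux C5 `ManinPrimeToAdditiveFiveLe` (stmt-BirchSwinnertonDyer-22969):
# **the Kosters–Pannekoek core of C5 IS crux KP57 (stmt-BirchSwinnertonDyer-23810) modulo print, and
# C5 BY NAME ⟸ {F′, F″, ČNS, Cremona ≤ 5·10⁵ (cite-only facts), KP57 (open crux), stub 2 (reducible residue)}**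

CONDITIONAL wiring (a `--supports` helper; C5 is NOT proved here; this thin file carries the cone of route
`EdixhovenFibreFiveSeven`'s theses because it cites its crux KP57 BY NAME). The Kato reduction
(`…KatoReduction`, p608285) left on the `W[p]`-irreducible locus exactly one open core (KP): `p ∈ {5,7}`,
`W` globally minimal and additive at `p` with `E[p]` irreducible and a `ℚ_p`-RATIONAL POINT OF ORDER `p`,
`D` lattice-optimal at level `N(W)` ⟹ `p ∤ c(D)`. This file identifies (KP), modulo print, with the
registered crux KP57 `EdixhovenFibreFiveSeven.KPResidueManinUnitFiveSeven` (stmt-BirchSwinnertonDyer-23810,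
cell `pub/bsd-wall`): KP57 concludes «SOME conductor-level datum of `V` has `p ∤ c`» under the extra
clauses «no `Iₙ*` fibre, `ord_p Δ_min ≤ 4`» (automatic here: a point of order `p` in `W(ℚ_p)` at an
additive `p ≥ 5` forces `(p, ord_p Δ_min) ∈ {(5,2),(5,3),(7,2)}`, Mazur 1977 III §5 Step 1, tree
`padicValInt_minimalDiscriminantInt_of_prime_zsmul_eq_zero_of_addv`), «every conductor-level degree in the
class divisible by `p`» (else Česnavičius–Neururer–Saha Thm 1.2, cite-only fact
`cesnaviciusNeururerSaha_padicVal_maninConstant_le_modularDegree`, gives a datum with `p ∤ c` by the tree's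
`ManinFrameTransport.exists_modularParametrizationData_not_dvd_of_not_dvd_modularDegree`) and «`N > 5·10⁵`»
(else Cremona's table, cite-only fact `cremona_abs_maninConstant_eq_one_of_level_le_500000`); and «some datum
with `p ∤ c`» gives `p ∤ c` at the LATTICE-OPTIMAL datum (`ManinFrameTransport.not_dvd_optimal_c_of_exists_not_dvd`:
`c₀ ∣ k·c` with `p ∤ k`).

* §1 `coreKP_of_kp57_of_cns_of_cremona` — (KP) ⟸ KP57 ∧ ČNS ∧ Cremona ∧ modularity (for the level of
  the partner datum in the ČNS slice).
* §2 `maninLocalTwoThree_maninPrimeToAdditiveFiveLe_of_kato_of_kp57_of_reducible` — **C5 BY NAME ⟸ F′ ∧ F″ ∧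
  ČNS ∧ Cremona ∧ KP57 ∧ stub 2** (stub 2 = the registered `stub_reducibleTwistMinimal` of line
  `upper_anchor`, VERBATIM as a hypothesis): every input is a NAMED tree fact (cite-only, statement-only) or a
  REGISTERED open item; the frame is p587193 and the irreducible locus is `…KatoReduction` §1.

HONEST SCOPE. Conditional on four unproved cite-only facts (F′, F″ = derived readings of Kato 2004 +
Kim–Nakamura 2020; ČNS 2024 Thm 1.2; Cremona's `|c| = 1` for `N ≤ 5·10⁵`), on the OPEN crux KP57 of another
route, and on the open reducible residue; closes nothing. BSD is not proved by this; C5 is not proved by this;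
Manin's conjecture is not proved by this. Seat bsd-line-ml23-c5-p1 (lead).

References: [KostersPannekoek2017] Thm. 1, Cor. 2; [Mazur1977] Ch. III §5 Step 1; [CesnaviciusNeururerSaha2023]
Thm. 1.2 and §1 p. 2 ([Cre22]); [Kato2004Asterisque] (8.1.3), Thm. 9.7; [KimNakamura2020] Cor. 2.4;
[EdixhovenManin1991] Prop. 2.
-/

set_option autoImplicit false
set_option linter.dupNamespace false

noncomputable section

open scoped Classical

namespace Summit.BirchSwinnertonDyer.BirchSwinnertonDyer.Theorems

open WeierstrassCurve IsDedekindDomain IsDedekindDomain.HeightOneSpectrum Rat.HeightOneSpectrum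
  Literature.NumberTheory.DiophantineGeometry
  Literature.NumberTheory.EllipticCurves Literature.NumberTheory.EllipticCurves.ModularForms
  Literature.NumberTheory.EllipticCurves.Rank1Residual
  Summit.BirchSwinnertonDyer.Rank1Residual.Additive
  Summit.BirchSwinnertonDyer.Rank1Residual.ManinAdditive
  Summit.BirchSwinnertonDyer.BirchSwinnertonDyer.Theses.EdixhovenFibreFiveSeven

/-! ## §1 The Kosters–Pannekoek core of C5 from KP57, ČNS and Cremona -/

/-- **(KP) ⟸ KP57 ∧ ČNS ∧ Cremona (∧ modularity).** For `W/ℚ` globally minimal with a lattice-optimal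
datum `D` at level `N(W)`, `p ∈ {5,7}`, `p² ∣ N(W)`, `E[p]` irreducible and a point of order `p` in
`W(ℚ_p)`: `p ∤ c(D)` — GRANTED crux KP57 (stmt-BirchSwinnertonDyer-23810, hypothesis `hKP57`, its registered
statement BY NAME), the cite-only facts ČNS Thm 1.2 (`hCNS`) and Cremona `N ≤ 5·10⁵` (`h500k`), and
modularity (`hnf`, only to place the partner datum of the ČNS slice at level `N(W)`). The torsion point
forces Kodaira II/III at `5`, II at `7` (so `ord_p Δ_min ≤ 4`, no `Iₙ*`); Cremona's range and the ČNS
degree slice are peeled off; KP57 gives a datum with `p ∤ c`, which descends to the lattice-optimal datum.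
CONDITIONAL; closes nothing. [cite: KostersPannekoek2017, Thm. 1 and Cor. 2]
[cite: Mazur1977, Ch. III §5, Step 1, p. 158] [cite: CesnaviciusNeururerSaha2023, Thm. 1.2]
[cite: EdixhovenManin1991, Prop. 2] -/
theorem coreKP_of_kp57_of_cns_of_cremona
    (hKP57 : KPResidueManinUnitFiveSeven)
    (hCNS : cesnaviciusNeururerSaha_padicVal_maninConstant_le_modularDegree)
    (h500k : cremona_abs_maninConstant_eq_one_of_level_le_500000)
    (hnf : exists_isNewformOf)
    (W : WeierstrassCurve ℚ) [W.IsElliptic] [W.IsGloballyMinimal] [NeZero (W.conductorNorm ℤ)]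
    (D : ModularParametrizationData W (W.conductorNorm ℤ)) (hD : IsLatticeOptimal D)
    {p : ℕ} [Fact p.Prime] (h57 : p = 5 ∨ p = 7) (hpN : p ^ 2 ∣ W.conductorNorm ℤ)
    (hirr : W.HasIrreducibleModPGaloisRep p)
    (hT : ∃ P : (W.baseChange ℚ_[p]).toAffine.Point, p • P = 0 ∧ P ≠ 0) :
    ¬ (p : ℤ) ∣ D.c := by
  have hp : p.Prime := Fact.out
  have hp5 : 5 ≤ p := by rcases h57 with rfl | rfl <;> norm_num
  have hadd : Addv W p := not_good_and_not_mult_of_sq_dvd_conductorNorm W hpN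
  obtain ⟨P, hP, hP0⟩ := hT
  have hP' : (p : ℤ) • P = 0 := by rw [natCast_zsmul]; exact hP
  -- the torsion point pins the Kodaira type: `ord_p Δ_min ∈ {2, 3}`
  have hv3 : padicValInt p W.minimalDiscriminantInt ≤ 3 := by
    rcases padicValInt_minimalDiscriminantInt_of_prime_zsmul_eq_zero_of_addv W p hp5 hadd hP0 hP' with
      ⟨-, h | h⟩ | ⟨-, h⟩ <;> omega
  have hv4 : padicValInt p W.minimalDiscriminantInt ≤ 4 := by omega
  have hK : ∀ (v : HeightOneSpectrum ℤ) (n : ℕ), natGenerator v = p →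
      W.kodairaSymbolAt v ≠ KodairaSymbol.Istar n := by
    intro v n hv hk
    rw [eq_placeOf_of_natGenerator_eq v hv] at hk
    rcases kodairaSymbolAt_placeOf_cases_of_addv W p hp5 hadd with
      ⟨h, _⟩ | ⟨h, _⟩ | ⟨h, _⟩ | ⟨m, h, hm⟩ | ⟨h, _⟩ | ⟨h, _⟩ | ⟨h, _⟩
    · rw [hk] at h; exact KodairaSymbol.noConfusion h
    · rw [hk] at h; exact KodairaSymbol.noConfusion h
    · rw [hk] at h; exact KodairaSymbol.noConfusion h
    · omega
    · rw [hk] at h; exact KodairaSymbol.noConfusion h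
    · rw [hk] at h; exact KodairaSymbol.noConfusion h
    · rw [hk] at h; exact KodairaSymbol.noConfusion h
  -- a datum of `W` with `p ∤ c` descends to the lattice-optimal one
  have descend : (∃ Dt : ModularParametrizationData W (W.conductorNorm ℤ), ¬ (p : ℤ) ∣ Dt.c) →
      ¬ (p : ℤ) ∣ D.c := fun h ↦
    ManinFrameTransport.not_dvd_optimal_c_of_exists_not_dvd W hp hirr h (isIsogenous_self W) D hD
  -- Cremona's range
  by_cases hN : W.conductorNorm ℤ ≤ 500000
  · have h1 : |D.maninConstant| = 1 := h500k W D hD hN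
    intro hdvd
    have h1' : (p : ℤ) ∣ 1 := by
      rw [← h1]
      exact (dvd_abs _ _).mpr hdvd
    have := Int.eq_one_of_dvd_one (by positivity) h1'
    have hp1 : p = 1 := by exact_mod_cast this
    exact hp.one_lt.ne' hp1
  · push Not at hN
    -- the ČNS degree slice
    by_cases hdeg : ∀ (W' : WeierstrassCurve ℚ) [W'.IsElliptic] [W'.IsGloballyMinimal]
        (D' : ModularParametrizationData W' (W.conductorNorm ℤ)), IsIsogenous W W' → p ∣ D'.modularDegree
    · exact descend (hKP57 p W h57 hadd hirr hK hv4
        ⟨W, inferInstance, inferInstance, P, isIsogenous_self W, hP0, hP⟩ hdeg hN)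
    · push Not at hdeg
      obtain ⟨W', hE', hM', D', hiso, hdeg'⟩ := hdeg
      exact descend (ManinFrameTransport.exists_modularParametrizationData_not_dvd_of_not_dvd_modularDegree
        hnf hCNS W hp hp5 hirr hiso D' hdeg')

/-! ## §2 C5 by name from named facts, the open crux KP57 and the reducible residue -/

/-- **C5 `ManinLocalTwoThree.ManinPrimeToAdditiveFiveLe` ⟸ {F′, F″, ČNS, Cremona ≤ 5·10⁵} (cite-only facts)
∧ KP57 (stmt-BirchSwinnertonDyer-23810, open crux, BY NAME) ∧ stub 2 (`stub_reducibleTwistMinimal` of line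
`upper_anchor`, VERBATIM).** Frame: the route helper p587193 (globally twist-minimal normal form); irreducible
locus: `maninLocalTwoThree_not_dvd_maninConstant_of_kato_of_irreducible` (F′, F″) off the Kosters–Pannekoek
exception and §1 on it; reducible locus: the hypothesis `hRED`. CONDITIONAL: C5 is NOT proved; every
hypothesis is a named tree fact or a registered open item. [cite: Kato2004Asterisque, (8.1.3) (p. 180), Thm. 9.7 (p. 189)]
[cite: KimNakamura2020, Cor. 2.4] [cite: KostersPannekoek2017, Thm. 1 and Cor. 2]
[cite: CesnaviciusNeururerSaha2023, Thm. 1.2] -/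
theorem maninLocalTwoThree_maninPrimeToAdditiveFiveLe_of_kato_of_kp57_of_reducible
    (hK : kato_neron_isIntegral_twistedSymbolSum_of_additive)
    (hK57 : kato_neron_isIntegral_twistedSymbolSum_of_additive_five_le)
    (hCNS : cesnaviciusNeururerSaha_padicVal_maninConstant_le_modularDegree)
    (h500k : cremona_abs_maninConstant_eq_one_of_level_le_500000)
    (hKP57 : KPResidueManinUnitFiveSeven)
    (hRED : mazur_not_dvd_maninConstant_of_odd → abbesUllmo_not_dvd_maninConstant_of_not_dvd_level →
      cesnavicius_not_two_dvd_maninConstant_of_two_dvd_level → exists_isNewformOf →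
      ∀ (W : WeierstrassCurve ℚ) [W.IsElliptic] [W.IsGloballyMinimal] [NeZero (W.conductorNorm ℤ)]
        (D : ModularParametrizationData W (W.conductorNorm ℤ)),
        IsLatticeOptimal D → ∀ p : ℕ, p.Prime → 5 ≤ p → p ^ 2 ∣ W.conductorNorm ℤ →
        ¬ (∃ (W' : WeierstrassCurve ℚ) (q : ℕ), W'.IsElliptic ∧ W'.IsGloballyMinimal ∧ q.Prime ∧
            q ≠ 2 ∧ q ^ 2 ∣ W.conductorNorm ℤ ∧
            IsIsogenous W (W'.quadraticTwist (((-1 : ℤ) ^ (q / 2) * q : ℤ) : ℚ)) ∧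
            ¬ q ^ 2 ∣ W'.conductorNorm ℤ) →
        ¬ (∃ (W' : WeierstrassCurve ℚ) (d : ℤ), W'.IsElliptic ∧ W'.IsGloballyMinimal ∧
            (d = -1 ∨ d = 2 ∨ d = -2) ∧ 2 ^ 2 ∣ W.conductorNorm ℤ ∧
            IsIsogenous W (W'.quadraticTwist (d : ℚ)) ∧ ¬ 2 ^ 2 ∣ W'.conductorNorm ℤ) →
        ¬ W.HasIrreducibleModPGaloisRep p →
        ¬ (p : ℤ) ∣ D.maninConstant) :
    Summit.BirchSwinnertonDyer.BirchSwinnertonDyer.Theses.ManinLocalTwoThree.ManinPrimeToAdditiveFiveLe := by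
  refine maninLocalTwoThree_maninPrimeToAdditiveFiveLe_of_globallyTwistMinimal ?_
  intro hM hAU hC hnf W hE hGM N hN0 D hopt p hp h5 hpN hodd hdy
  haveI hpF : Fact p.Prime := ⟨hp⟩
  have hN : N = W.conductorNorm ℤ :=
    IsNewformOf.level_eq_conductorNorm_of_exists_isNewformOf hnf D.isNewformOf
  subst hN
  have hD : IsLatticeOptimal D := hopt
  by_cases hirr : W.HasIrreducibleModPGaloisRep p
  · by_cases hT : ∃ P : (W.baseChange ℚ_[p]).toAffine.Point, p • P = 0 ∧ P ≠ 0
    · by_cases h57 : p = 5 ∨ p = 7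
      · exact coreKP_of_kp57_of_cns_of_cremona hKP57 hCNS h500k hnf W D hD h57 hpN hirr hT
      · exact maninLocalTwoThree_not_dvd_maninConstant_of_kato_of_irreducible hK hK57 hnf W D hopt h5
          hpN hirr (fun h ↦ absurd h h57)
    · push Not at hT
      exact maninLocalTwoThree_not_dvd_maninConstant_of_kato_of_irreducible hK hK57 hnf W D hopt h5 hpN
        hirr (fun _ P hP ↦ hT P hP)
  · exact hRED hM hAU hC hnf W D hD p hp h5 hpN hodd hdy hirr

end Summit.BirchSwinnertonDyer.BirchSwinnertonDyer.Theorems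

end
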